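import Summits.NavierStokesRegularity.FunctionalMining.TopEigGapCutoffSmooth
import Summits.NavierStokesRegularity.FunctionalMining.TopEigGapFieldDeriv
import Summits.NavierStokesRegularity.FunctionalMining.TopEigColumnCharge
import HarnessLib

/-!
# FunctionalMining — L-λ(η), step (iv)(b): pointwise calculus of the cut-off fields
# `M^δ = G_δ(λ₁)·P₁` and `F^δ_k = G_δ(λ₁)·∂ₖλ₁` at a simple point, and the cut-off channel density

Search for candidate a priori estimates; no regularity claim. Cell `pub-nsfunc`, prove seat
(gen 26). Sequel of `TopEigGapCutoffSmooth` toward the dictionary's node `TopEigGapCoerciveTwo η`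
(Proposition L-λ(η) at `q = 2`). With `G = cutRamp δ`, `g = G' = cutStep δ ∈ [0, 1]`, `u₀ = topVec`,
`Sₖ = S(∂ₖv)(x)`, `a_k = u₀ᵀSₖu₀`, `A = ∑ₖ a_k²` (`topDiagSq`),
`R = ∑ₖ ∑_{b≠a₀} (u_bᵀSₖu₀)²/(λ₁ − κ_b)` (`topChannelW`), at a simple point `x`:

* `hasDerivAt_cutRamp_topEig_coordLine` — `t ↦ G(λ₁(x + t eₖ))` has derivative `g(λ₁)a_k` at `0`;
* `sum_sq_partialDeriv_cutProj_eq` — `∑ᵢⱼ (∂ₖ M^δᵢⱼ(x))² = (g(λ₁)a_k)² + 2 G(λ₁)² |N′ₖ|²`,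
  `|N′ₖ|² = ∑_{b≠a₀}(u_bᵀSₖu₀)²/(λ₁−κ_b)²` (`|P| = 1`, `P ⊥ ∂ₖP`);
* **`sum_sq_partialDeriv_cutProj_le_of_gap`** — on the top-gap class `λ₂ ≤ (1−η)λ₁` (`0 < η`):
  `∑ₖ∑ᵢⱼ (∂ₖ M^δᵢⱼ(x))² ≤ g(λ₁) A + (2/η) G(λ₁) R` (one factor `1/(λ₁−κ_b) ≤ 1/(ηλ₁)` only, and
  `G² ≤ λ₁ G`, `g² ≤ g`);
* `partialDeriv_cutFlux_eq`, **`sum_partialDeriv_cutFlux_eq`** —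
  `∑ₖ ∂ₖF^δ_k(x) = g(λ₁) A + G(λ₁) (μ(S;S(Δv)) + 2R)` (product rule + the R-form of `Δλ₁`);
* `cutDensity δ v x := 2 (∑ₖ ∂ₖF^δ_k(x) − G(λ₁(x)) μ(S(x);S(Δv)(x)))` — a GLOBAL function (the fluxes are
  smooth by `TopEigGapCutoffSmooth`); `cutDensity_eq_of_simple`: `= 2 g A + 4 G R` at a simple point,
  `cutDensity_eq_zero_of_lt`: `= 0` where `λ₁ < δ`; hence on the top-gap class
  **`sum_sq_partialDeriv_cutProj_le_cutDensity`**: `∑ₖᵢⱼ (∂ₖ M^δᵢⱼ)² ≤ (1/(2η)) · cutDensity` and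
  `cutDensity_nonneg`, at EVERY point (`0 < η ≤ 1`, `δ > 0`).

[ours]
-/

noncomputable section

open Filter Topology Matrix Finset MeasureTheory
open scoped ContDiff

namespace Summit.NavierStokesRegularity.FunctionalMining

open Literature.Analysis Literature.Analysis.FunctionSpaces Literature.Analysis.FunctionSpaces.Torus
  SharpClass.DirectorForm Literature.Analysis.Matrix

namespace TopEig

variable {v : UnitAddTorus (Fin 3) → EuclideanSpace ℝ (Fin 3)}

/-! ## 1. The objects -/

/-- `u₀(x)` is the eigenbasis vector of index `topIndex v x`. [ours, bookkeeping] -/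
theorem ofLp_eigenvectorBasis_topIndex (v : UnitAddTorus (Fin 3) → EuclideanSpace ℝ (Fin 3))
    (x : UnitAddTorus (Fin 3)) :
    ((torusStrainMatrix_isHermitian v x).eigenvectorBasis (topIndex v x)).ofLp = topVec v x := rfl

/-- **`A(x) = ∑ₖ (u₀ᵀ S(∂ₖv)(x) u₀)²`** — the diagonal (Hellmann–Feynman) part of the squared
`e₁`-column of `∇S` (`= |∇λ₁|²` at a simple point). [ours, bookkeeping] -/
def topDiagSq (v : UnitAddTorus (Fin 3) → EuclideanSpace ℝ (Fin 3)) (x : UnitAddTorus (Fin 3)) : ℝ :=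
  ∑ k, (topVec v x ⬝ᵥ (torusStrainMatrix (Torus.partialDeriv k v) x *ᵥ topVec v x)) ^ 2

/-- **`R(x) = ∑ₖ ∑_{b ≠ a₀} (u_bᵀ S(∂ₖv)(x) u₀)² / (λ₁(x) − κ_b)`** — the weighted channel sum of the
R-form of `Δλ₁` (`Δλ₁ = μ + 2R` at a simple point, `laplacian_torusStrainTopEig_eq_sum_frame`).
[ours, bookkeeping] -/
def topChannelW (v : UnitAddTorus (Fin 3) → EuclideanSpace ℝ (Fin 3)) (x : UnitAddTorus (Fin 3)) : ℝ :=
  ∑ k, ∑ b ∈ Finset.univ.erase (topIndex v x),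
    (((torusStrainMatrix_isHermitian v x).eigenvectorBasis b).ofLp ⬝ᵥ
        (torusStrainMatrix (Torus.partialDeriv k v) x *ᵥ topVec v x)) ^ 2 /
      (torusStrainTopEig v x - (torusStrainMatrix_isHermitian v x).eigenvalues b)

/-- **The cut-off projector field `M^δᵢⱼ = G_δ(λ₁) · (topProj)ᵢⱼ`.** [ours] -/
def cutProj (δ : ℝ) (v : UnitAddTorus (Fin 3) → EuclideanSpace ℝ (Fin 3)) (i j : Fin 3)
    (x : UnitAddTorus (Fin 3)) : ℝ :=
  cutRamp δ (torusStrainTopEig v x) * topProj v x i j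

/-- **The cut-off flux `F^δ_k = G_δ(λ₁) · ∂ₖλ₁`.** [ours] -/
def cutFlux (δ : ℝ) (v : UnitAddTorus (Fin 3) → EuclideanSpace ℝ (Fin 3)) (k : Fin 3)
    (x : UnitAddTorus (Fin 3)) : ℝ :=
  cutRamp δ (torusStrainTopEig v x) * Torus.partialDeriv k (torusStrainTopEig v) x

/-- **The cut-off channel density `ρ^δ(x) := 2 (∑ₖ ∂ₖF^δ_k(x) − G_δ(λ₁(x)) · μ(S(x); S(Δv)(x)))`** —
globally defined; `= 2 g A + 4 G R ≥ 0` at simple points and `= 0` where `λ₁ < δ`. [ours] -/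
def cutDensity (δ : ℝ) (v : UnitAddTorus (Fin 3) → EuclideanSpace ℝ (Fin 3))
    (x : UnitAddTorus (Fin 3)) : ℝ :=
  2 * (∑ k, Torus.partialDeriv k (cutFlux δ v k) x -
    cutRamp δ (torusStrainTopEig v x) *
      dirTopEig (StrainL4.strainFlat v x) (StrainL4.strainFlat (Torus.laplacian v) x))

/-- `A(x) ≥ 0`. [ours, bookkeeping] -/
theorem topDiagSq_nonneg (v : UnitAddTorus (Fin 3) → EuclideanSpace ℝ (Fin 3)) (x : UnitAddTorus (Fin 3)) :
    0 ≤ topDiagSq v x :=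
  Finset.sum_nonneg fun _ _ => sq_nonneg _

/-- `R(x) ≥ 0` at a simple point (`λ₁ − κ_b > 0` for `b ≠ a₀`). [ours, bookkeeping] -/
theorem topChannelW_nonneg {x : UnitAddTorus (Fin 3)} (hx : torusStrainMidEig v x < torusStrainTopEig v x) :
    0 ≤ topChannelW v x := by
  refine Finset.sum_nonneg fun k _ => Finset.sum_nonneg fun b hb => div_nonneg (sq_nonneg _) ?_
  have hle := eigenvalues_le_midEig_of_ne hx (eigenvalues_topIndex v x) (Finset.ne_of_mem_erase hb)
  linarith

/-! ## 2. The cut-off projector field at a simple point -/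

/-- Along `t ↦ x + t eₖ` through a simple point, `G_δ(λ₁)` has derivative `g_δ(λ₁(x)) · u₀ᵀS(∂ₖv)(x)u₀`
at `0`. [ours] -/
theorem hasDerivAt_cutRamp_topEig_coordLine (hv : Torus.IsSmooth v) (δ : ℝ)
    {x : UnitAddTorus (Fin 3)} (hx : torusStrainMidEig v x < torusStrainTopEig v x) (k : Fin 3) :
    HasDerivAt (fun t : ℝ => cutRamp δ (torusStrainTopEig v (x + proj (t • EuclideanSpace.single k (1 : ℝ)))))
      (cutStep δ (torusStrainTopEig v x) *
        (topVec v x ⬝ᵥ (torusStrainMatrix (Torus.partialDeriv k v) x *ᵥ topVec v x))) 0 := by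
  have h1 := hasDerivAt_topEig_coordLine hv hx (eigenvalues_topIndex v x) k
  have h2 := hasDerivAt_cutRamp δ (torusStrainTopEig v (x + proj ((0 : ℝ) • EuclideanSpace.single k (1 : ℝ))))
  have h := h2.comp 0 h1
  rw [coordLine_zero] at h
  exact h

/-- **`∑ᵢⱼ (∂ₖ M^δᵢⱼ(x))² = (g(λ₁)a_k)² + 2 G(λ₁)² |N′ₖ|²`** at a simple point, with
`|N′ₖ|² = ∑_{b≠a₀}(u_bᵀSₖu₀)²/(λ₁−κ_b)²`. [ours] -/
theorem sum_sq_partialDeriv_cutProj_eq (hv : Torus.IsSmooth v) (δ : ℝ)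
    {x : UnitAddTorus (Fin 3)} (hx : torusStrainMidEig v x < torusStrainTopEig v x) (k : Fin 3) :
    ∑ i, ∑ j, (Torus.partialDeriv k (cutProj δ v i j) x) ^ 2 =
      (cutStep δ (torusStrainTopEig v x) *
          (topVec v x ⬝ᵥ (torusStrainMatrix (Torus.partialDeriv k v) x *ᵥ topVec v x))) ^ 2 +
        2 * cutRamp δ (torusStrainTopEig v x) ^ 2 *
          ∑ b ∈ Finset.univ.erase (topIndex v x),
            ((((torusStrainMatrix_isHermitian v x).eigenvectorBasis b).ofLp ⬝ᵥ
                (torusStrainMatrix (Torus.partialDeriv k v) x *ᵥ topVec v x)) /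
              (torusStrainTopEig v x - (torusStrainMatrix_isHermitian v x).eigenvalues b)) ^ 2 := by
  obtain ⟨he1, hSe, hgap⟩ := gapForm_eigenvectorBasis hx (eigenvalues_topIndex v x)
  rw [ofLp_eigenvectorBasis_topIndex] at he1 hSe hgap
  set e : Fin 3 → ℝ := topVec v x with hedef
  set M : Matrix (Fin 3) (Fin 3) ℝ := torusStrainMatrix (Torus.partialDeriv k v) x with hMdef
  have hg : 0 < torusStrainTopEig v x - torusStrainMidEig v x := sub_pos.2 hx
  obtain ⟨N', hder, h0, hnorm⟩ := hasDerivAt_topProj_coordLine hv hx (eigenvalues_topIndex v x) k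
  rw [ofLp_eigenvectorBasis_topIndex] at hder h0 hnorm
  have hG := hasDerivAt_cutRamp_topEig_coordLine hv δ hx k
  set c : ℝ := cutStep δ (torusStrainTopEig v x) * (e ⬝ᵥ (M *ᵥ e)) with hcdef
  set Gx : ℝ := cutRamp δ (torusStrainTopEig v x) with hGx
  -- value of `topProj` at `x`: `e ⊗ e`
  have hP0 : ∀ i j, topProj v (x + proj ((0 : ℝ) • EuclideanSpace.single k (1 : ℝ))) i j = e i * e j := by
    intro i j
    rw [coordLine_zero]
    rfl
  have hG0 : cutRamp δ (torusStrainTopEig v (x + proj ((0 : ℝ) • EuclideanSpace.single k (1 : ℝ)))) = Gx := by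
    rw [coordLine_zero]
  -- the derivative of each entry of `G(λ₁) · P`
  have hpd : ∀ i j, Torus.partialDeriv k (cutProj δ v i j) x =
      c * (e i * e j) + Gx * (N' i * e j + e i * N' j) := by
    intro i j
    have h := hG.mul (hder i j)
    rw [hP0 i j, hG0] at h
    exact h.deriv
  simp_rw [hpd]
  -- expand the square: `|P| = 1`, `P ⊥ P′`, `|P′|² = 2|N′|²`
  have hexp : ∀ i j, (c * (e i * e j) + Gx * (N' i * e j + e i * N' j)) ^ 2 =
      c ^ 2 * ((e i * e i) * (e j * e j)) + Gx ^ 2 * (N' i * e j + e i * N' j) ^ 2 +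
        2 * c * Gx * ((e i * N' i) * (e j * e j) + (e i * e i) * (e j * N' j)) := by
    intro i j; ring
  simp_rw [hexp, Finset.sum_add_distrib, ← Finset.mul_sum, ← Finset.sum_mul]
  have h1 : ∑ j, e j * e j = 1 := by simpa [dotProduct] using he1
  have h2 : ∑ i, e i * N' i = 0 := by simpa [dotProduct, mul_comm] using h0
  have hcross : ∑ i, ∑ j, (e i * N' i * (e j * e j) + e i * e i * (e j * N' j)) = 0 := by
    have hin : ∀ i, ∑ j, (e i * N' i * (e j * e j) + e i * e i * (e j * N' j)) =
        e i * N' i * (∑ j, e j * e j) + e i * e i * (∑ j, e j * N' j) := fun i => by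
      rw [Finset.sum_add_distrib, Finset.mul_sum, Finset.mul_sum]
    simp_rw [hin, h1, h2, mul_one, mul_zero, add_zero]
    exact h2
  rw [sum_sq_projDeriv_eq he1 h0, h1, hcross, hnorm]
  ring

/-- **On the top-gap class, `∑ₖ∑ᵢⱼ (∂ₖ M^δᵢⱼ(x))² ≤ g(λ₁) A + (2/η) G(λ₁) R` at a simple point.** For
`v` smooth and divergence free, `0 < η`, `x ∈ U_s` with `λ₂(x) ≤ (1−η)λ₁(x)`: the diagonal term uses
`g² ≤ g`, each channel uses ONE factor `1/(λ₁−κ_b) ≤ 1/(ηλ₁)` and `G(λ₁)² ≤ λ₁ G(λ₁)`. [ours] -/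
theorem sum_sq_partialDeriv_cutProj_le_of_gap (hv : Torus.IsSmooth v) (hdiv : Torus.IsDivFree v)
    {δ : ℝ} {η : ℝ} (hη0 : 0 < η)
    {x : UnitAddTorus (Fin 3)} (hx : torusStrainMidEig v x < torusStrainTopEig v x)
    (hgapx : torusStrainMidEig v x ≤ (1 - η) * torusStrainTopEig v x) :
    ∑ k, ∑ i, ∑ j, (Torus.partialDeriv k (cutProj δ v i j) x) ^ 2 ≤
      cutStep δ (torusStrainTopEig v x) * topDiagSq v x +
        2 / η * cutRamp δ (torusStrainTopEig v x) * topChannelW v x := by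
  obtain ⟨he1, hSe, hgap⟩ := gapForm_eigenvectorBasis hx (eigenvalues_topIndex v x)
  have hg : 0 < torusStrainTopEig v x - torusStrainMidEig v x := sub_pos.2 hx
  set lam : ℝ := torusStrainTopEig v x with hlam
  have hlam0 : 0 < lam := (lam_pos_of_gapForm_of_isDivFree hv hdiv he1 hSe hg hgap).2
  set gx : ℝ := cutStep δ lam with hgx
  set Gx : ℝ := cutRamp δ lam with hGx
  have hgx0 : 0 ≤ gx := cutStep_nonneg δ lam
  have hGx0 : 0 ≤ Gx := cutRamp_nonneg hlam0.le
  have hg2 : gx ^ 2 ≤ gx := cutStep_sq_le δ lam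
  have hG2 : Gx ^ 2 ≤ lam * Gx := cutRamp_sq_le hlam0.le
  unfold topDiagSq topChannelW
  rw [Finset.mul_sum, Finset.mul_sum, ← Finset.sum_add_distrib]
  refine Finset.sum_le_sum fun k _ => ?_
  rw [sum_sq_partialDeriv_cutProj_eq hv δ hx k]
  set a : ℝ := topVec v x ⬝ᵥ (torusStrainMatrix (Torus.partialDeriv k v) x *ᵥ topVec v x) with hadef
  -- termwise channel bound with one factor `1/(ηλ₁)`
  have hW : ∑ b ∈ Finset.univ.erase (topIndex v x),
      ((((torusStrainMatrix_isHermitian v x).eigenvectorBasis b).ofLp ⬝ᵥ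
          (torusStrainMatrix (Torus.partialDeriv k v) x *ᵥ topVec v x)) /
        (lam - (torusStrainMatrix_isHermitian v x).eigenvalues b)) ^ 2 ≤
      (η * lam)⁻¹ * ∑ b ∈ Finset.univ.erase (topIndex v x),
        (((torusStrainMatrix_isHermitian v x).eigenvectorBasis b).ofLp ⬝ᵥ
            (torusStrainMatrix (Torus.partialDeriv k v) x *ᵥ topVec v x)) ^ 2 /
          (lam - (torusStrainMatrix_isHermitian v x).eigenvalues b) := by
    rw [Finset.mul_sum]
    refine Finset.sum_le_sum fun b hb => ?_
    have hne : b ≠ topIndex v x := (Finset.mem_erase.1 hb).1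
    have hle := eigenvalues_le_midEig_of_ne hx (eigenvalues_topIndex v x) hne
    set cb : ℝ := ((torusStrainMatrix_isHermitian v x).eigenvectorBasis b).ofLp ⬝ᵥ
      (torusStrainMatrix (Torus.partialDeriv k v) x *ᵥ topVec v x)
    set gap : ℝ := lam - (torusStrainMatrix_isHermitian v x).eigenvalues b with hgapdef
    have hga : η * lam ≤ gap := by rw [hgapdef]; nlinarith
    have hηl : 0 < η * lam := mul_pos hη0 hlam0
    have hgap0 : 0 < gap := lt_of_lt_of_le hηl hga
    rw [div_pow, sq gap, ← div_div, div_eq_mul_inv (cb ^ 2 / gap), mul_comm (cb ^ 2 / gap)]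
    exact mul_le_mul_of_nonneg_right (inv_anti₀ hηl hga) (div_nonneg (sq_nonneg _) hgap0.le)
  set Rk : ℝ := ∑ b ∈ Finset.univ.erase (topIndex v x),
    (((torusStrainMatrix_isHermitian v x).eigenvectorBasis b).ofLp ⬝ᵥ
        (torusStrainMatrix (Torus.partialDeriv k v) x *ᵥ topVec v x)) ^ 2 /
      (lam - (torusStrainMatrix_isHermitian v x).eigenvalues b) with hRk
  have hRk0 : 0 ≤ Rk := Finset.sum_nonneg fun b hb => by
    have hle := eigenvalues_le_midEig_of_ne hx (eigenvalues_topIndex v x) (Finset.ne_of_mem_erase hb)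
    exact div_nonneg (sq_nonneg _) (by linarith)
  -- (g a)² ≤ g a²
  have hdiag : (gx * a) ^ 2 ≤ gx * a ^ 2 := by
    rw [mul_pow]; exact mul_le_mul_of_nonneg_right hg2 (sq_nonneg _)
  -- 2 G² W ≤ (2/η) G R
  have hchan : 2 * Gx ^ 2 * ∑ b ∈ Finset.univ.erase (topIndex v x),
      ((((torusStrainMatrix_isHermitian v x).eigenvectorBasis b).ofLp ⬝ᵥ
          (torusStrainMatrix (Torus.partialDeriv k v) x *ᵥ topVec v x)) /
        (lam - (torusStrainMatrix_isHermitian v x).eigenvalues b)) ^ 2 ≤ 2 / η * Gx * Rk := by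
    have h1 : 2 * Gx ^ 2 * ∑ b ∈ Finset.univ.erase (topIndex v x),
        ((((torusStrainMatrix_isHermitian v x).eigenvectorBasis b).ofLp ⬝ᵥ
            (torusStrainMatrix (Torus.partialDeriv k v) x *ᵥ topVec v x)) /
          (lam - (torusStrainMatrix_isHermitian v x).eigenvalues b)) ^ 2 ≤
        2 * Gx ^ 2 * ((η * lam)⁻¹ * Rk) := mul_le_mul_of_nonneg_left hW (by positivity)
    have h2 : 2 * Gx ^ 2 * ((η * lam)⁻¹ * Rk) ≤ 2 * (lam * Gx) * ((η * lam)⁻¹ * Rk) :=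
      mul_le_mul_of_nonneg_right (mul_le_mul_of_nonneg_left hG2 (by norm_num))
        (mul_nonneg (inv_nonneg.2 (mul_pos hη0 hlam0).le) hRk0)
    have e : 2 * (lam * Gx) * ((η * lam)⁻¹ * Rk) = 2 / η * Gx * Rk := by
      have hl : lam ≠ 0 := hlam0.ne'
      field_simp
    linarith
  linarith

/-! ## 3. The cut-off flux at a simple point -/

/-- `∂ₖ F^δ_k(x) = g(λ₁) a_k · ∂ₖλ₁(x) + G(λ₁) ∂ₖ∂ₖλ₁(x)` at a simple point, and `∂ₖλ₁(x) = a_k`, so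
**`∂ₖ F^δ_k(x) = g(λ₁) a_k² + G(λ₁) ∂ₖ∂ₖλ₁(x)`**. [ours] -/
theorem partialDeriv_cutFlux_eq (hv : Torus.IsSmooth v) (δ : ℝ)
    {x : UnitAddTorus (Fin 3)} (hx : torusStrainMidEig v x < torusStrainTopEig v x) (k : Fin 3) :
    Torus.partialDeriv k (cutFlux δ v k) x =
      cutStep δ (torusStrainTopEig v x) *
          (topVec v x ⬝ᵥ (torusStrainMatrix (Torus.partialDeriv k v) x *ᵥ topVec v x)) ^ 2 +
        cutRamp δ (torusStrainTopEig v x) *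
          Torus.partialDeriv k (Torus.partialDeriv k (torusStrainTopEig v)) x := by
  have hG := hasDerivAt_cutRamp_topEig_coordLine hv δ hx k
  have hD := hasDerivAt_coordLine_of_contDiffAt (contDiffAt_liftAt_partialDeriv_topEig_of_simple hv hx k) k
  have hHF : Torus.partialDeriv k (torusStrainTopEig v) x =
      topVec v x ⬝ᵥ (torusStrainMatrix (Torus.partialDeriv k v) x *ᵥ topVec v x) := by
    rw [← ofLp_eigenvectorBasis_topIndex]
    exact (partialDeriv_partialDeriv_torusStrainTopEig_eq_sum_frame hv hx (eigenvalues_topIndex v x) k).1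
  have h := hG.mul hD
  have hval : Torus.partialDeriv k (torusStrainTopEig v)
      (x + proj ((0 : ℝ) • EuclideanSpace.single k (1 : ℝ))) =
      topVec v x ⬝ᵥ (torusStrainMatrix (Torus.partialDeriv k v) x *ᵥ topVec v x) := by
    rw [coordLine_zero, hHF]
  have hG0 : cutRamp δ (torusStrainTopEig v (x + proj ((0 : ℝ) • EuclideanSpace.single k (1 : ℝ)))) =
      cutRamp δ (torusStrainTopEig v x) := by rw [coordLine_zero]
  rw [hval, hG0] at h
  have h' : HasDerivAt (fun t : ℝ => cutFlux δ v k (x + proj (t • EuclideanSpace.single k (1 : ℝ))))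
      (cutStep δ (torusStrainTopEig v x) *
          (topVec v x ⬝ᵥ (torusStrainMatrix (Torus.partialDeriv k v) x *ᵥ topVec v x)) *
          (topVec v x ⬝ᵥ (torusStrainMatrix (Torus.partialDeriv k v) x *ᵥ topVec v x)) +
        cutRamp δ (torusStrainTopEig v x) *
          Torus.partialDeriv k (Torus.partialDeriv k (torusStrainTopEig v)) x) 0 := h
  show deriv (fun t : ℝ => cutFlux δ v k (x + proj (t • EuclideanSpace.single k (1 : ℝ)))) 0 = _
  rw [h'.deriv]
  ring

/-- **`∑ₖ ∂ₖ F^δ_k(x) = g(λ₁) A + G(λ₁) (μ(S;S(Δv)) + 2 R)`** at a simple point: product rule,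
`∑ₖ ∂ₖ∂ₖλ₁ = Δλ₁` (chart `C²`), and the R-form `Δλ₁ = u₀ᵀS(Δv)u₀ + 2R` with
`μ(S;S(Δv)) = u₀ᵀS(Δv)u₀` at a simple point. [ours] -/
theorem sum_partialDeriv_cutFlux_eq (hv : Torus.IsSmooth v) (δ : ℝ)
    {x : UnitAddTorus (Fin 3)} (hx : torusStrainMidEig v x < torusStrainTopEig v x) :
    ∑ k, Torus.partialDeriv k (cutFlux δ v k) x =
      cutStep δ (torusStrainTopEig v x) * topDiagSq v x +
        cutRamp δ (torusStrainTopEig v x) *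
          (dirTopEig (StrainL4.strainFlat v x) (StrainL4.strainFlat (Torus.laplacian v) x) +
            2 * topChannelW v x) := by
  simp_rw [partialDeriv_cutFlux_eq hv δ hx]
  rw [Finset.sum_add_distrib, ← Finset.mul_sum, ← Finset.mul_sum]
  have hlap : ∑ k, Torus.partialDeriv k (Torus.partialDeriv k (torusStrainTopEig v)) x =
      Torus.laplacian (torusStrainTopEig v) x :=
    (laplacian_eq_sum_partialDeriv_partialDeriv_of_contDiffAt
      ((contDiffAt_liftAt_torusStrainTopEig_of_midEig_lt hv hx).of_le (by norm_cast))).symm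
  obtain ⟨he1, hSe, hgap⟩ := gapForm_eigenvectorBasis hx (eigenvalues_topIndex v x)
  have hg : 0 < torusStrainTopEig v x - torusStrainMidEig v x := sub_pos.2 hx
  have hμ := dirTopEig_strainFlat_eq_of_gapForm he1 hSe hg hgap (Torus.laplacian v)
  have hR := laplacian_torusStrainTopEig_eq_sum_frame hv hx (eigenvalues_topIndex v x)
  rw [ofLp_eigenvectorBasis_topIndex] at hμ hR
  rw [hlap, hR, hμ]
  unfold topDiagSq topChannelW
  rfl

/-! ## 4. The cut-off channel density -/

/-- **At a simple point, `cutDensity δ v x = 2 g(λ₁) A + 4 G(λ₁) R`.** [ours] -/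
theorem cutDensity_eq_of_simple (hv : Torus.IsSmooth v) (δ : ℝ)
    {x : UnitAddTorus (Fin 3)} (hx : torusStrainMidEig v x < torusStrainTopEig v x) :
    cutDensity δ v x =
      2 * cutStep δ (torusStrainTopEig v x) * topDiagSq v x +
        4 * cutRamp δ (torusStrainTopEig v x) * topChannelW v x := by
  unfold cutDensity
  rw [sum_partialDeriv_cutFlux_eq hv δ hx]
  ring

/-- **Where `λ₁(x) < δ`, `cutDensity δ v x = 0`** (the fluxes vanish near `x`, `G_δ(λ₁(x)) = 0`).
[ours] -/
theorem cutDensity_eq_zero_of_lt (hv : Torus.IsSmooth v) {δ : ℝ} (hδ : 0 < δ)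
    {x : UnitAddTorus (Fin 3)} (hx : torusStrainTopEig v x < δ) : cutDensity δ v x = 0 := by
  unfold cutDensity
  have h0 : ∀ k, Torus.partialDeriv k (cutFlux δ v k) x = 0 := fun k =>
    partialDeriv_cutRamp_topEig_mul_eq_zero hv hδ _ hx k
  simp_rw [h0]
  rw [Finset.sum_const_zero, cutRamp_of_le hδ hx.le]
  ring

/-- Where `λ₁(x) < δ`, every `∂ₖ M^δᵢⱼ(x) = 0`. [ours, bookkeeping] -/
theorem partialDeriv_cutProj_eq_zero_of_lt (hv : Torus.IsSmooth v) {δ : ℝ} (hδ : 0 < δ)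
    {x : UnitAddTorus (Fin 3)} (hx : torusStrainTopEig v x < δ) (k i j : Fin 3) :
    Torus.partialDeriv k (cutProj δ v i j) x = 0 :=
  partialDeriv_cutRamp_topEig_mul_eq_zero hv hδ _ hx k

/-- **THE POINTWISE COMPARISON ON THE TOP-GAP CLASS.** For `v` smooth and divergence free on `T³`,
`0 < η ≤ 1`, `δ > 0` and `λ₂ ≤ (1−η)λ₁` at every point:
`∑ₖ∑ᵢⱼ (∂ₖ M^δᵢⱼ(x))² ≤ (1/(2η)) · cutDensity δ v x` at EVERY `x` (simple points: §2–§4 and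
`g A + (2/η) G R ≤ (1/(2η))(2 g A + 4 G R)` as `η ≤ 1`; points with `λ₁ < δ`: both sides vanish).
[ours] -/
theorem sum_sq_partialDeriv_cutProj_le_cutDensity (hv : Torus.IsSmooth v) (hdiv : Torus.IsDivFree v)
    {δ η : ℝ} (hδ : 0 < δ) (hη0 : 0 < η) (hη1 : η ≤ 1)
    (hgap : ∀ x : UnitAddTorus (Fin 3), torusStrainMidEig v x ≤ (1 - η) * torusStrainTopEig v x)
    (x : UnitAddTorus (Fin 3)) :
    ∑ k, ∑ i, ∑ j, (Torus.partialDeriv k (cutProj δ v i j) x) ^ 2 ≤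
      1 / (2 * η) * cutDensity δ v x := by
  by_cases hlt : torusStrainTopEig v x < δ
  · simp_rw [partialDeriv_cutProj_eq_zero_of_lt hv hδ hlt]
    rw [cutDensity_eq_zero_of_lt hv hδ hlt]
    simp
  · have hx := simple_of_le_topEig_of_gap hη0 hδ hgap x (not_lt.1 hlt)
    have h1 := sum_sq_partialDeriv_cutProj_le_of_gap (δ := δ) hv hdiv hη0 hx (hgap x)
    rw [cutDensity_eq_of_simple hv δ hx]
    have hA0 := topDiagSq_nonneg v x
    have hR0 := topChannelW_nonneg hx
    have hg0 := cutStep_nonneg δ (torusStrainTopEig v x)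
    have hG0 : 0 ≤ cutRamp δ (torusStrainTopEig v x) := cutRamp_nonneg (le_of_lt (lt_of_lt_of_le hδ (not_lt.1 hlt)))
    have hgA : 0 ≤ cutStep δ (torusStrainTopEig v x) * topDiagSq v x := mul_nonneg hg0 hA0
    have hGR : 0 ≤ cutRamp δ (torusStrainTopEig v x) * topChannelW v x := mul_nonneg hG0 hR0
    have e : 1 / (2 * η) * (2 * cutStep δ (torusStrainTopEig v x) * topDiagSq v x +
        4 * cutRamp δ (torusStrainTopEig v x) * topChannelW v x) =
        1 / η * (cutStep δ (torusStrainTopEig v x) * topDiagSq v x) +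
          2 / η * cutRamp δ (torusStrainTopEig v x) * topChannelW v x := by
      field_simp
      ring
    rw [e]
    have hcoef : cutStep δ (torusStrainTopEig v x) * topDiagSq v x ≤
        1 / η * (cutStep δ (torusStrainTopEig v x) * topDiagSq v x) := by
      have h1η : (1 : ℝ) ≤ 1 / η := by rw [le_div_iff₀ hη0]; linarith
      nlinarith
    linarith

/-- On the top-gap class (`0 < η`, `δ > 0`), **`0 ≤ cutDensity δ v x` at every point**. [ours] -/
theorem cutDensity_nonneg (hv : Torus.IsSmooth v) (hdiv : Torus.IsDivFree v)
    {δ η : ℝ} (hδ : 0 < δ) (hη0 : 0 < η)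
    (hgap : ∀ x : UnitAddTorus (Fin 3), torusStrainMidEig v x ≤ (1 - η) * torusStrainTopEig v x)
    (x : UnitAddTorus (Fin 3)) : 0 ≤ cutDensity δ v x := by
  by_cases hlt : torusStrainTopEig v x < δ
  · rw [cutDensity_eq_zero_of_lt hv hδ hlt]
  · have hx := simple_of_le_topEig_of_gap hη0 hδ hgap x (not_lt.1 hlt)
    rw [cutDensity_eq_of_simple hv δ hx]
    have hA0 := topDiagSq_nonneg v x
    have hR0 := topChannelW_nonneg hx
    have hg0 := cutStep_nonneg δ (torusStrainTopEig v x)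
    have hG0 : 0 ≤ cutRamp δ (torusStrainTopEig v x) :=
      cutRamp_nonneg (le_of_lt (lt_of_lt_of_le hδ (not_lt.1 hlt)))
    have _ := hdiv
    positivity

end TopEig

end Summit.NavierStokesRegularity.FunctionalMining

end
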